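import Summits.Ventures.PercRepro.RankLevelSetBiIndepMixedExchange
import Summits.Ventures.PercRepro.RankLevelSetBiIndepAvoidNormSkew

/-! # RankLevelSetBiIndepMixedNormSkew — THE PER-SET AVOID LADDER: (CUM-norm) ON THE MINORS GIVES THE NORMALIZED
SKEW OF EVERY MIXED PROFILE AND THE FULL NORMALIZED HALF RULE OF EVERY AVOID-`X` PROFILE — (AVOID-norm)_X:
`β^X_i · C(#E − #X, j) ≤ β^X_j · C(#E − #X, i)` FOR `i < j`, `i + j ≤ #E − #X` — HENCE (★★)_X, (AVOID-cum)_X AND MONO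
(night-1 g31; dossier §43.7)

Let `q^{Y₁,Y₂}_k = mixedCount M Y₁ Y₂ k` (bi-independent `k`-sets containing `Y₁` and avoiding `Y₂`), `b = #Y₂`.
Under (CUM-norm) on every minor of `M`, simultaneously for all minors `N` and by induction on `b`:
* (W) `NormSkew (q^{Y₁,Y₂}) (#E − b − 1)` for every `Y₁`, and
* (S) `NormSkew (q^{∅,Y₂}) (#E − b)` — the FULL normalized half rule of the avoid-`Y₂` profile
(**`mixedCount_normSkew_aux`**). Base `b = 0`: (W) is the level-indexed contain profile of a (CUM-norm) matroid
(`normSkew_biContainCount_of_normSkew`), (S) is Mono (the ladder). Step at `y ∈ Y₂`: the free part is the mixed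
family of `M ／ {y}` with `Y₂ ∖ {y}` (parameter `(#E − 1) − (b − 1) − 1`, resp. `(#E − 1) − (b − 1)`: exactly the
target); the absorbing part is the sum over the circuits `C ∋ y` of the fibres, each a mixed family of
`(M ／ {y}) ＼ {x}` shifted by one level (`ncard_mixedFibre_eq`; (W) on `#E − 2` elements with `b − 1`, parameter
`#E − b − 2`, plus `2` for the shift: `#E − b` — the target of (S) exactly, one to spare for (W);
**`mixedAbsorb_normSkew`**); a fibre whose circuit lies in `Y₂ ∪ {y}` is empty, a loop `y` empties everything.
COROLLARIES: **`mixedCount_avoid_normSkew`** ((AVOID-norm)_X for every `X ⊆ E`), **`mixedCount_avoid_skew`**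
((AVOID-cum)_X: `Skew (β^X) (#E − #X)`), **`mixedCount_avoid_reflect`** ((★★)_X: `β^X_i ≤ β^X_j` for `i < j`,
`i + j = #E − #X`). These are the per-set statements of dossier §43.7, census-clean on every matroid with ≤ 9
elements and every `X` (kit j319909: 0 / 685,738,479 pairs); summed over the `c`-sets they are Mono. Every
declaration has a docstring; imports: the cell's own modules and Mathlib only. Axioms: standard. -/

namespace PercRepro

open Set Matroid

variable {α : Type} (M : Matroid α) [M.Finite]

/-- A loop empties every mixed family. -/
lemma mixedCount_eq_zero_of_loop {ℓ : α} (hℓE : ℓ ∈ M.E) (hℓ : ¬ M.Indep {ℓ}) (Y₁ Y₂ : Set α) (k : ℕ) :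
    mixedCount M Y₁ Y₂ k = 0 := by
  have h0 : biContainCount M ∅ k = 0 := biContainCount_eq_zero_of_loop M hℓE hℓ ∅ k
  rw [biContainCount_empty] at h0
  unfold biIndepCount at h0
  unfold mixedCount
  have hsub : mixedSets M Y₁ Y₂ k ⊆ biIndep M k := fun Z hZ => hZ.1
  exact Nat.eq_zero_of_le_zero ((Set.ncard_le_ncard hsub (biIndep_finite M k)).trans h0.le)

omit [M.Finite] in
/-- If the contain- and avoid-sets meet, the mixed family is empty. -/
lemma mixedCount_eq_zero_of_not_disjoint {Y₁ Y₂ : Set α} (h : ¬ Disjoint Y₁ Y₂) (k : ℕ) :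
    mixedCount M Y₁ Y₂ k = 0 := by
  unfold mixedCount
  have he : mixedSets M Y₁ Y₂ k = ∅ := by
    apply Set.eq_empty_of_forall_notMem
    rintro Z ⟨-, hY₁, hd⟩
    exact h (hd.mono_left hY₁)
  rw [he, Set.ncard_empty]

/-- **The absorbing part at a non-loop `y ∈ Y₂` is normalized-skew with parameter `#E − b − 1`** (`#Y₂ = b + 1`),
given (W) with parameter `#E′ − b − 1` for the minors `(N ／ {y}) ＼ {x}` and their mixed families with `b` avoided
elements: each fibre is such a family shifted by one level. -/
lemma mixedAbsorb_normSkew {N : Matroid α} [N.Finite] {y : α} (hy : N.Indep {y}) {Y₁ Y₂ : Set α}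
    (hY₁ : Y₁ ⊆ N.E) (hY₂ : Y₂ ⊆ N.E) (hyY : y ∈ Y₂) (hd : Disjoint Y₁ Y₂) {b : ℕ} (hb : Y₂.ncard = b + 1)
    (ih : ∀ (N' : Matroid α) [N'.Finite], Matroid.IsMinor N' N → ∀ Y₁' Y₂' : Set α, Y₁' ⊆ N'.E → Y₂' ⊆ N'.E →
      Y₂'.ncard = b → SkewConv.NormSkew (fun k => mixedCount N' Y₁' Y₂' k) (N'.E.ncard - b - 1)) :
    SkewConv.NormSkew (fun k => (mixedAbsorb N Y₁ Y₂ y k).ncard) (N.E.ncard - b - 1) := by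
  classical
  have hyE : y ∈ N.E := hY₂ hyY
  have hY₂' : (Y₂ \ {y}).ncard = b := by
    rw [Set.ncard_sdiff_singleton_of_mem hyY, hb]
    rfl
  have hcirc : ∀ C ∈ circuitsThroughAt N y,
      SkewConv.NormSkew (fun k => (mixedFibre N Y₁ Y₂ y C k).ncard) (N.E.ncard - b - 1) := by
    intro C hC
    rw [mem_circuitsThroughAt] at hC
    by_cases hsub : C \ {y} ⊆ Y₂
    · refine SkewConv.normSkew_congr (SkewConv.normSkew_zero _) fun k _ => ?_
      rw [mixedFibre_eq_empty_of_subset N hC.1 hC.2 hy hsub k, Set.ncard_empty]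
    · obtain ⟨x, hxC', hxY⟩ : ∃ x ∈ C \ {y}, x ∉ Y₂ := by
        by_contra hcon
        push Not at hcon
        exact hsub fun z hz => hcon z hz
      have hxC : x ∈ C := hxC'.1
      have hxy : x ≠ y := fun hh => hxC'.2 (Set.mem_singleton_iff.mpr hh)
      have hxE : x ∈ N.E := hC.1.subset_ground hxC
      set N' := (N.contract {y}).delete {x} with hN'
      have hN'min : Matroid.IsMinor N' N := ⟨{y}, {x}, rfl⟩
      haveI : N'.Finite := ⟨N.ground_finite.subset hN'min.subset⟩
      have hx' : x ∈ N.E \ {y} := ⟨hxE, fun hh => hxy (Set.mem_singleton_iff.mp hh)⟩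
      have hN'card : N'.E.ncard = N.E.ncard - 2 := by
        rw [hN', minor_ground_eq', Set.ncard_sdiff_singleton_of_mem hx', Set.ncard_sdiff_singleton_of_mem hyE]
        omega
      have hyY₁ : y ∉ Y₁ := fun hh => (Set.disjoint_left.mp hd) hh hyY
      have hY₁'' : (Y₁ ∪ (C \ {y})) \ {x} ⊆ N'.E := by
        rw [hN', minor_ground_eq']
        rintro z ⟨hz, hzx⟩
        refine ⟨⟨?_, ?_⟩, hzx⟩
        · rcases hz with hz | hz
          · exact hY₁ hz
          · exact hC.1.subset_ground hz.1
        · rcases hz with hz | hz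
          · exact fun hzy => hyY₁ (Set.mem_singleton_iff.mp hzy ▸ hz)
          · exact hz.2
      have hY₂'' : Y₂ \ {y} ⊆ N'.E := by
        rw [hN', minor_ground_eq']
        rintro z ⟨hz, hzy⟩
        exact ⟨⟨hY₂ hz, hzy⟩, fun hzx => hxY (Set.mem_singleton_iff.mp hzx ▸ hz)⟩
      have hW := ih N' hN'min _ _ hY₁'' hY₂'' hY₂'
      rw [hN'card] at hW
      have hshift := SkewConv.normSkew_shift hW 1
      refine SkewConv.normSkew_congr (SkewConv.normSkew_mono hshift (by omega)) fun k _ => ?_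
      rcases k with _ | i
      · simp only [SkewConv.shiftSeq]
        rw [if_neg (by omega), mixedFibre_zero_eq_empty N hC.1 hC.2 hy, Set.ncard_empty]
      · simp only [SkewConv.shiftSeq, Nat.succ_le_succ_iff, Nat.zero_le, if_true, Nat.add_sub_cancel]
        exact (ncard_mixedFibre_eq N hC.1 hC.2 hxC hxy hy hxY i).symm
  have hsum := SkewConv.normSkew_sum (circuitsThroughAt N y) (fun C k => (mixedFibre N Y₁ Y₂ y C k).ncard) hcirc
  exact SkewConv.normSkew_congr hsum fun k _ => (ncard_mixedAbsorb_eq_sum N hyE hyY k).symm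

omit [M.Finite] in
/-- **THE PER-SET AVOID LADDER** (the induction on `#Y₂`, for all minors simultaneously): under (CUM-norm) on the
minors of `M`, for every minor `N`, every `Y₁, Y₂ ⊆ E(N)` with `#Y₂ = b`: (W) `NormSkew (q^{Y₁,Y₂}) (#E(N) − b − 1)`
and (S) `NormSkew (q^{∅,Y₂}) (#E(N) − b)`. -/
theorem mixedCount_normSkew_aux (h : ∀ N : Matroid α, Matroid.IsMinor N M → BiContainNormSkew N) :
    ∀ (b : ℕ) (N : Matroid α) [N.Finite], Matroid.IsMinor N M → ∀ Y₁ Y₂ : Set α, Y₁ ⊆ N.E → Y₂ ⊆ N.E →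
      Y₂.ncard = b →
      SkewConv.NormSkew (fun k => mixedCount N Y₁ Y₂ k) (N.E.ncard - b - 1) ∧
      SkewConv.NormSkew (fun k => mixedCount N ∅ Y₂ k) (N.E.ncard - b) := by
  intro b
  induction b with
  | zero =>
    intro N _ hNM Y₁ Y₂ hY₁ hY₂ hb
    have hY₂e : Y₂ = ∅ := (Set.ncard_eq_zero (N.ground_finite.subset hY₂)).mp hb
    subst hY₂e
    constructor
    · rw [Nat.sub_zero]
      refine SkewConv.normSkew_congr (normSkew_biContainCount_of_normSkew N (h N hNM) hY₁) fun k _ => ?_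
      exact (mixedCount_empty_right N Y₁ k).symm
    · rw [Nat.sub_zero]
      have hmono : BiIndepMono N :=
        biIndepMono_of_forall_minor_normSkew N fun N' hN' => h N' (hN'.trans hNM)
      refine SkewConv.normSkew_congr (normSkew_biIndepCount_of_mono N hmono) fun k _ => ?_
      rw [mixedCount_empty_right, biContainCount_empty]
  | succ b ih =>
    intro N _ hNM Y₁ Y₂ hY₁ hY₂ hb
    obtain ⟨y, hyY⟩ := Set.nonempty_of_ncard_ne_zero (by omega : Y₂.ncard ≠ 0)
    have hyE : y ∈ N.E := hY₂ hyY
    have hY₂' : (Y₂ \ {y}).ncard = b := by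
      rw [Set.ncard_sdiff_singleton_of_mem hyY, hb]
      rfl
    by_cases hy : N.Indep {y}
    · have hynl : N.IsNonloop y := Matroid.indep_singleton.mp hy
      -- the contraction `N ／ {y}` as a minor of `M`
      have hcmin : Matroid.IsMinor (N.contract {y}) N := ⟨{y}, ∅, (Matroid.delete_empty _).symm⟩
      haveI : (N.contract {y}).Finite := ⟨N.ground_finite.subset hcmin.subset⟩
      have hccard : (N.contract {y}).E.ncard = N.E.ncard - 1 := by
        rw [Matroid.contract_ground, Set.ncard_sdiff_singleton_of_mem hyE]
      have hY₂c : Y₂ \ {y} ⊆ (N.contract {y}).E := by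
        rw [Matroid.contract_ground]
        exact Set.sdiff_subset_sdiff_left hY₂
      -- the inductive hypothesis (W) for the minors of `N`
      have ihW : ∀ (N' : Matroid α) [N'.Finite], Matroid.IsMinor N' N → ∀ Y₁' Y₂' : Set α, Y₁' ⊆ N'.E →
          Y₂' ⊆ N'.E → Y₂'.ncard = b →
          SkewConv.NormSkew (fun k => mixedCount N' Y₁' Y₂' k) (N'.E.ncard - b - 1) :=
        fun N' _ hN' Y₁' Y₂' h1 h2 h3 => (ih N' (hN'.trans hNM) Y₁' Y₂' h1 h2 h3).1
      constructor
      · -- (W)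
        by_cases hd : Disjoint Y₁ Y₂
        · have hyY₁ : y ∉ Y₁ := fun hh => (Set.disjoint_left.mp hd) hh hyY
          have hY₁c : Y₁ ⊆ (N.contract {y}).E := by
            rw [Matroid.contract_ground]
            exact fun z hz => ⟨hY₁ hz, fun hzy => hyY₁ (Set.mem_singleton_iff.mp hzy ▸ hz)⟩
          have hfree := (ih (N.contract {y}) (hcmin.trans hNM) Y₁ (Y₂ \ {y}) hY₁c hY₂c hY₂').1
          rw [hccard] at hfree
          have habs := mixedAbsorb_normSkew hy hY₁ hY₂ hyY hd hb ihW
          have hsum : SkewConv.NormSkew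
              (fun k => mixedCount (N.contract {y}) Y₁ (Y₂ \ {y}) k + (mixedAbsorb N Y₁ Y₂ y k).ncard)
              (N.E.ncard - (b + 1) - 1) :=
            SkewConv.normSkew_add (SkewConv.normSkew_mono hfree (by omega))
              (SkewConv.normSkew_mono habs (by omega))
          refine SkewConv.normSkew_congr hsum fun k _ => ?_
          rw [mixedCount_eq_free_add_absorb N Y₁ Y₂ y k, mixedFree_eq_contract N hynl hyY k]
          rfl
        · exact SkewConv.normSkew_congr (SkewConv.normSkew_zero _) fun k _ =>
            (mixedCount_eq_zero_of_not_disjoint N hd k).symm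
      · -- (S)
        have hfree := (ih (N.contract {y}) (hcmin.trans hNM) ∅ (Y₂ \ {y}) (Set.empty_subset _) hY₂c hY₂').2
        rw [hccard] at hfree
        have habs := mixedAbsorb_normSkew hy (Set.empty_subset _) hY₂ hyY (Set.empty_disjoint _) hb ihW
        have hsum : SkewConv.NormSkew
            (fun k => mixedCount (N.contract {y}) ∅ (Y₂ \ {y}) k + (mixedAbsorb N ∅ Y₂ y k).ncard)
            (N.E.ncard - (b + 1)) :=
          SkewConv.normSkew_add (SkewConv.normSkew_mono hfree (by omega))
            (SkewConv.normSkew_mono habs (by omega))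
        refine SkewConv.normSkew_congr hsum fun k _ => ?_
        rw [mixedCount_eq_free_add_absorb N ∅ Y₂ y k, mixedFree_eq_contract N hynl hyY k]
        rfl
    · -- `y` is a loop: every mixed family is empty
      constructor
      · exact SkewConv.normSkew_congr (SkewConv.normSkew_zero _) fun k _ =>
          (mixedCount_eq_zero_of_loop N hyE hy Y₁ Y₂ k).symm
      · exact SkewConv.normSkew_congr (SkewConv.normSkew_zero _) fun k _ =>
          (mixedCount_eq_zero_of_loop N hyE hy ∅ Y₂ k).symm

/-- **(AVOID-norm)_X FROM (CUM-norm) ON THE MINORS**: for every `X ⊆ E`, the avoid-`X` profile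
`β^X_k = #{Z ∈ D_k : Z ∩ X = ∅}` satisfies the full normalized half rule `NormSkew (β^X) (#E − #X)`. -/
theorem mixedCount_avoid_normSkew (h : ∀ N : Matroid α, Matroid.IsMinor N M → BiContainNormSkew N)
    {X : Set α} (hX : X ⊆ M.E) :
    SkewConv.NormSkew (fun k => mixedCount M ∅ X k) (M.E.ncard - X.ncard) :=
  (mixedCount_normSkew_aux M h X.ncard M Matroid.IsMinor.refl ∅ X (Set.empty_subset _) hX rfl).2

/-- **(MIX-norm) FROM (CUM-norm) ON THE MINORS**: every mixed profile satisfies `NormSkew (q^{Y₁,Y₂}) (#E − #Y₂ − 1)`. -/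
theorem mixedCount_normSkew (h : ∀ N : Matroid α, Matroid.IsMinor N M → BiContainNormSkew N)
    {Y₁ Y₂ : Set α} (hY₁ : Y₁ ⊆ M.E) (hY₂ : Y₂ ⊆ M.E) :
    SkewConv.NormSkew (fun k => mixedCount M Y₁ Y₂ k) (M.E.ncard - Y₂.ncard - 1) :=
  (mixedCount_normSkew_aux M h Y₂.ncard M Matroid.IsMinor.refl Y₁ Y₂ hY₁ hY₂ rfl).1

/-- **(AVOID-cum)_X**: the avoid-`X` profile is cumulatively skewed about `(#E − #X)/2`. -/
theorem mixedCount_avoid_skew (h : ∀ N : Matroid α, Matroid.IsMinor N M → BiContainNormSkew N)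
    {X : Set α} (hX : X ⊆ M.E) :
    SkewConv.Skew (fun k => mixedCount M ∅ X k) (M.E.ncard - X.ncard) :=
  SkewConv.normSkew_skew (mixedCount_avoid_normSkew M h hX)

/-- **(★★)_X**: `β^X_i ≤ β^X_j` for `i < j` with `i + j = #E − #X` (at `#X = 1` this is (★★); summed over the
`c`-sets `X` it is the cumulative Mono at the pair `(i, j)`). -/
theorem mixedCount_avoid_reflect (h : ∀ N : Matroid α, Matroid.IsMinor N M → BiContainNormSkew N)
    {X : Set α} (hX : X ⊆ M.E) {i j : ℕ} (hij : i < j) (hsum : i + j = M.E.ncard - X.ncard) :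
    mixedCount M ∅ X i ≤ mixedCount M ∅ X j :=
  mixedCount_avoid_skew M h hX i j hij hsum.le

end PercRepro
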